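/-
Copyright (c) 2026. All rights reserved.
Released under Apache 2.0 license as described in the file LICENSE.
-/
import Summits.ValiantsHypothesis.ValiantsHypothesis.Theorems.SPDChasmCeiling
import HarnessLib
import HarnessLib.Audit

/-!
# The plain shifted-partials floor for the permanent (non-vacuity of the chasm ceiling)

Companion of `Theorems/SPDChasmCeiling.lean`.  That file shows, unconditionally, that the
plain shifted-partials method (`SPDCertifies f s D t`, Gupta–Kamath–Kayal–Saptharishi 2014,
Cor. 10) certifies NOTHING against top fan-in `s ≥ (n·n)^{⌊√n⌋+1}` at bottom degree
`t = ⌊√n⌋`, for ANY polynomial of degree `≤ n` in the `n × n` matrix variables — in particular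
below every depth-4 chasm door.  A barrier over a technique class is informative only if the
class is non-empty in the same currency; this file supplies that witness from the
kernel-checked GKKS lower bound (`GKKSDepthFourProofs`): for every field `K`, every `c₀` and
`M = 2600(c₀+1)`, the method DOES certify `per_n ∉ ΣΠ^{[c₀√n]}ΣΠ^{[√n]}` against every top
fan-in `s < 2^{√n/M}` (`n ≥ 4M²`) — and `2^{√n/M} < (n·n)^{⌊√n⌋+1}`, so floor and ceiling are
consistent: the window `[2^{√n/M}, (n·n)^{⌊√n⌋+1})` is exactly where the plain measure lives on
the chasm axis.  Helper for the crux `Depth4HomFour` (route Depth4); no new facts, no tag moves.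

References: Gupta–Kamath–Kayal–Saptharishi, J. ACM 61 (2014), Thm. 2, Cor. 10, Cor. 16, §7.
-/

set_option linter.dupNamespace false

noncomputable section

open MvPolynomial
open Literature.Computability.AlgebraicComplexity
open Literature.Computability.AlgebraicComplexity.GKKS
open Summit.ValiantsHypothesis.ValiantsHypothesis.Theorems.SPDChasmCeiling

namespace Summit.ValiantsHypothesis.ValiantsHypothesis.Theorems.SPDChasmFloor

/-- **The floor (non-vacuity of `SPDCertifies` on the chasm axis).**  For every field `K` and
every `c₀`, with `M = 2600(c₀+1)`: for all `n ≥ 4M²` and every top fan-in `s < 2^{√n/M}`, the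
plain shifted-partials method certifies `per_n ∉ ΣΠ^{[c₀⌊√n⌋]}ΣΠ^{[⌊√n⌋]}` with top fan-in
`s` — the certificate being the GKKS block family (`k = ⌊√n/M⌋` derivatives, shift
`ℓ = n²⌊√n⌋`).  This is the contrapositive reading of the kernel-checked GKKS Theorem 2
(`gkks_depth4_holds`), exposing the certificate instead of the lower bound.
[cite: GuptaKamathKayalSaptharishi2014, Thm. 2, Cor. 16] -/
theorem spdCertifies_per_floor (K : Type) [Field K] (c₀ : ℕ) :
    ∃ M : ℕ, 0 < M ∧ ∀ n : ℕ, 4 * M ^ 2 ≤ n → ∀ s : ℕ,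
      (s : ℝ) < (2 : ℝ) ^ (Real.sqrt n / M) →
        SPDCertifies (perPoly (Fin n) K) s (c₀ * Nat.sqrt n) (Nat.sqrt n) := by
  -- `M' = 1300 (c₀ + 1)`, kept opaque (large numerals must not be unfolded by `whnf`)
  obtain ⟨M', hM'def⟩ : ∃ M' : ℕ, M' = 1300 * (c₀ + 1) := ⟨_, rfl⟩
  have hM'ge : 1300 * (c₀ + 1) ≤ M' := hM'def.ge
  have hMpos : 0 < 2 * M' := by omega
  refine ⟨2 * M', hMpos, fun n hn s hs => ?_⟩
  -- the GKKS block family: `k = ⌊√n / 2M'⌋` blocks of length `L = ⌊n/k⌋`, `h = ⌊L/2⌋`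
  have hkkM : Nat.sqrt n / (2 * M') * (2 * M') ≤ Nat.sqrt n := Nat.div_mul_le_self _ _
  have ht2M : 2 * (2 * M') ≤ Nat.sqrt n := by
    rw [Nat.le_sqrt]
    calc 2 * (2 * M') * (2 * (2 * M')) = 4 * (2 * M') ^ 2 := by ring
      _ ≤ n := hn
  have hkk1 : 1 ≤ Nat.sqrt n / (2 * M') := by
    rw [Nat.le_div_iff_mul_le hMpos]; omega
  let P : Blocks :=
    { n := n, k := Nat.sqrt n / (2 * M'), L := n / (Nat.sqrt n / (2 * M'))
      h := n / (Nat.sqrt n / (2 * M')) / 2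
      two_h_le := Nat.mul_div_le _ 2
      kL_le := Nat.mul_div_le n _ }
  -- `h ≥ ⌊√n⌋ · M'`
  have hhh : Nat.sqrt n * M' ≤ P.h := by
    show Nat.sqrt n * M' ≤ n / (Nat.sqrt n / (2 * M')) / 2
    have h1 : Nat.sqrt n * (2 * M') ≤ n / (Nat.sqrt n / (2 * M')) := by
      rw [Nat.le_div_iff_mul_le (by omega)]
      calc Nat.sqrt n * (2 * M') * (Nat.sqrt n / (2 * M'))
          = Nat.sqrt n * (Nat.sqrt n / (2 * M') * (2 * M')) := by ring
        _ ≤ Nat.sqrt n * Nat.sqrt n := Nat.mul_le_mul_left _ hkkM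
        _ ≤ n := Nat.sqrt_le n
    calc Nat.sqrt n * M' = Nat.sqrt n * (2 * M') / 2 := by
          rw [show Nat.sqrt n * (2 * M') = Nat.sqrt n * M' * 2 by ring,
            Nat.mul_div_cancel _ two_pos]
      _ ≤ n / (Nat.sqrt n / (2 * M')) / 2 := Nat.div_le_div_right h1
  -- suppose the block-family certificate (order `k`, shift `ℓ = n²⌊√n⌋`) fails ...
  by_contra hcert
  -- ... then GKKS Cor. 16 (dimension from below) meets the failed certificate (dimension
  -- from above) in exactly the numeric inequality that GKKS §6 refutes for `s < 2^{√n/2M'}`.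
  have h1 := Blocks.finrank_shifted_ge (P := P) (fun _ => (1 : K)) (fun _ => one_ne_zero)
    (n * n * Nat.sqrt n)
  rw [fpoly_one] at h1
  have h2 : Module.finrank K (shifted P.dvars (n * n * Nat.sqrt n) (perPoly (Fin n) K)) ≤
      s * gateBound (Fin n × Fin n) (c₀ * Nat.sqrt n) P.k (Nat.sqrt n)
        (n * n * Nat.sqrt n) := by
    by_contra hlt
    exact hcert ⟨P.k, n * n * Nat.sqrt n, P.Theta, inferInstance, P.dvars,
      Blocks.length_dvars, not_le.1 hlt⟩
  rw [gateBound, card_degLE, Fintype.card_prod, Fintype.card_fin, ← mul_assoc] at h2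
  have hnum := numeric c₀ n s P.h M' hM'ge hn hhh (h1.trans h2)
  have e : Real.sqrt (n : ℝ) / ((2 * M' : ℕ) : ℝ) =
      (1 / ((2 * M' : ℕ) : ℝ)) * Real.sqrt (n : ℝ) := by
    ring
  rw [e] at hs
  exact absurd hnum (not_le.2 hs)

/-- **Floor below ceiling.** `2^{√n/M} < (n·n)^{⌊√n⌋+1}` for `M ≥ 1`, `n ≥ 2`: the fan-in range
where the plain method certifies (`spdCertifies_per_floor`) lies strictly below the range
where it provably cannot (`SPDChasmCeiling.not_spdCertifies_sqrt`). [folklore] -/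
theorem floor_lt_ceiling (M n : ℕ) (hM : 1 ≤ M) (hn : 2 ≤ n) :
    (2 : ℝ) ^ (Real.sqrt n / M) < (((n * n) ^ (Nat.sqrt n + 1) : ℕ) : ℝ) := by
  have h1 : Real.sqrt n / M ≤ ((Nat.sqrt n + 1 : ℕ) : ℝ) := by
    calc Real.sqrt n / M ≤ Real.sqrt n :=
          div_le_self (Real.sqrt_nonneg _) (by exact_mod_cast hM)
      _ ≤ (Nat.sqrt n : ℝ) + 1 := Real.real_sqrt_le_nat_sqrt_succ
      _ = ((Nat.sqrt n + 1 : ℕ) : ℝ) := by norm_cast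
  have h2 : (2 : ℕ) ^ (Nat.sqrt n + 1) < (n * n) ^ (Nat.sqrt n + 1) :=
    Nat.pow_lt_pow_left (by nlinarith) (Nat.succ_ne_zero _)
  calc (2 : ℝ) ^ (Real.sqrt n / M) ≤ (2 : ℝ) ^ ((Nat.sqrt n + 1 : ℕ) : ℝ) :=
        Real.rpow_le_rpow_of_exponent_le one_le_two h1
    _ = (((2 : ℕ) ^ (Nat.sqrt n + 1) : ℕ) : ℝ) := by rw [Real.rpow_natCast]; norm_cast
    _ < (((n * n) ^ (Nat.sqrt n + 1) : ℕ) : ℝ) := by exact_mod_cast h2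

/-- **The sandwich (the window of the plain measure on the chasm axis).**  For every field and
every `c₀`, with `M = 2600(c₀+1)`, for all `n ≥ 4M²`: (i) every top fan-in `s < 2^{√n/M}` IS
certified against by plain shifted partials for `per_n` at product fan-ins `(c₀⌊√n⌋, ⌊√n⌋)`;
(ii) NO `s ≥ (n·n)^{⌊√n⌋+1}` is, at any top product fan-in `D` — and by
`SPDChasmCeiling.ceiling_le_doorShape` / `…ceiling_le_tavenasDoor` that threshold lies below
every depth-4 chasm door; (iii) the two thresholds are consistent.  (Items (ii)–(iii) hold for
every `n ≥ 2`, (ii) for every polynomial of degree `≤ n`: see `SPDChasmCeiling`.)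
[cite: GuptaKamathKayalSaptharishi2014, Thm. 2, §7] -/
theorem spd_chasm_window (K : Type) [Field K] (c₀ : ℕ) :
    ∃ M : ℕ, 0 < M ∧ ∀ n : ℕ, 4 * M ^ 2 ≤ n →
      (∀ s : ℕ, (s : ℝ) < (2 : ℝ) ^ (Real.sqrt n / M) →
        SPDCertifies (perPoly (Fin n) K) s (c₀ * Nat.sqrt n) (Nat.sqrt n)) ∧
      (∀ s D : ℕ, (n * n) ^ (Nat.sqrt n + 1) ≤ s →
        ¬ SPDCertifies (perPoly (Fin n) K) s D (Nat.sqrt n)) ∧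
      (2 : ℝ) ^ (Real.sqrt n / M) < (((n * n) ^ (Nat.sqrt n + 1) : ℕ) : ℝ) := by
  obtain ⟨M, hM, hfloor⟩ := spdCertifies_per_floor K c₀
  have hM2 : 0 < M ^ 2 := pow_pos hM 2
  refine ⟨M, hM, fun n hn => ⟨hfloor n hn, fun s D hs => ?_, ?_⟩⟩
  · have hdeg : (perPoly (Fin n) K).totalDegree ≤ n := by
      simpa using (perPoly_isHomogeneous (n := Fin n) (k := K)).totalDegree_le
    exact not_spdCertifies_sqrt (by omega) (perPoly (Fin n) K) hdeg hs D
  · exact floor_lt_ceiling M n hM (by omega)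

end Summit.ValiantsHypothesis.ValiantsHypothesis.Theorems.SPDChasmFloor

end
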